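import Mathlib.NumberTheory.LSeries.Linearity
import Mathlib.NumberTheory.DirichletCharacter.Orthogonality
import Mathlib.NumberTheory.DirichletCharacter.Bounds
import Mathlib.RingTheory.RootsOfUnity.AlgebraicallyClosed
import Mathlib.Analysis.SpecialFunctions.Complex.CircleAddChar
import Mathlib.Analysis.Complex.Polynomial.Basic
import Mathlib.Data.Nat.Factorization.Induction
import Mathlib.Data.Nat.Factorization.Basic
import Literature.NumberTheory.LFunctions.AdditiveTwist
import HarnessLib

/-!
# Additive twists of multiplicative sequences are combinations of character twists
(pure proofs; companion to `Literature.NumberTheory.LFunctions.AdditiveTwist`)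

This file proves the ALGEBRAIC CORE of Booker's proof of his Lemma 1 (A. R. Booker, *Poles of
Artin L-functions and the strong Artin conjecture*, Ann. of Math. 158 (2003), Lemma 1 p. 1092,
proof pp. 1092–1093, eqs. (6)–(8)): for a rational `α`, the additive twist
`L(s, ρ, α) = ∑ aₙ e(-nα) n^{-s}` of an Euler product lies in the span `V` of the Dirichlet series
`q^{-s} L(s, ρ ⊗ χ)`, `q ≥ 1`, `χ` a Dirichlet character ("by the Chinese remainder theorem, the
additive twist by `α` can be built out of twists by `c/p^m` … it suffices to show that `V` is
stable under such twists … writing `n = p^k r` with `(r, p) = 1` … by Fourier analysis, the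
exponential may be written as a combination `∑ c_χ χ(r)` of characters `χ` to modulus `p^{m-k}`,
including imprimitive ones").  Precisely, for every sequence `a : ℕ → ℂ` which is multiplicative
on coprime arguments and every rational `x`:

* `LSeries.addTwistCoeff_mem_bookerSpan` — the twisted sequence `n ↦ a(n) e(nx)`
  (`LSeries.addTwistCoeff a x`) lies in `LSeries.bookerSpan a`, the `ℂ`-span of the sequences
  `LSeries.shiftSeq q (a · χ)` ("`a(n/q) χ(n/q)` if `q ∣ n`, else `0`", the coefficient sequence of
  `q^{-s} ∑ a(n) χ(n) n^{-s}`) over `q ≥ 1` and Dirichlet characters `χ` of all levels `M ≥ 1`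
  (for `a 0 = 0`; the value at `0` is irrelevant for Dirichlet series);
* `LSeries.exists_addTwist_eq_sum_charTwist` — hence there are finitely many `cᵢ ∈ ℂ`, `qᵢ ≥ 1`
  and Dirichlet characters `χᵢ` with
  `D_a(s; x) = ∑ a(n) e(nx) n^{-s} = ∑ᵢ cᵢ qᵢ^{-s} ∑ₙ a(n) χᵢ(n) n^{-s}` for every `s` at which
  the Dirichlet series of `a` converges absolutely (no hypothesis on `a 0`).

The proof follows Booker's: stability of the span under shifts, under multiplication by Dirichlet
characters, and under the twists by `c/p^m` (`LSeries.addTwistCoeff_primePow_eq`, the identity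
(6)–(8): split `n = p^k r`, expand `r ↦ e(rc/p^{m-k})` on `(ℤ/p^{m-k})ˣ` in Dirichlet characters by
the orthogonality relations, Mathlib `DirichletCharacter.sum_char_inv_mul_char_eq`), then the
Chinese-remainder / Bézout reduction of a general denominator to prime powers
(`Nat.recOnPrimeCoprime`, `Nat.gcd_eq_gcd_ab`).  One simplification with respect to the printed
proof: we twist by the NAIVE character twists `n ↦ a(n) χ(n)` (imprimitive at the primes dividing
the level), so that Booker's reinstated Euler factors `E_p(s)` never appear — all coefficients of
the combination are monomials `b(p^k) p^{-ks}`; the identification of `∑ a(n)χ(n) n^{-s}` with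
`L(s, ρ ⊗ χ_prim)` up to finitely many Euler factors is left to the analytic step.

What is NOT here (status of the named fact `Booker2003_lemma1` of `AdditiveTwist.lean`): the
analytic input of Booker's proof — each `L(s, ρ ⊗ χ)` is meromorphic on `ℂ` with poles only in
`0 < Re s < 1` — needs, besides the Artin–Brauer meromorphic continuation (proved in the tree,
`Literature.NumberTheory.Automorphic.artinLFunction_hasMeromorphicContinuation`), Artin's
functional equation for the twists (named fact
`Literature.NumberTheory.Automorphic.artin_functional_equation`, not yet discharged) for the
half-plane `Re s ≤ 0`, and the regularity of Artin L-functions of non-trivial irreducible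
representations on `Re s = 1` (named fact
`Literature.NumberTheory.GaloisRepresentations.artinLFunction_order_at_one` at `s = 1`); the
discharge `Booker2003_lemma1_holds` waits for those.

No named facts are introduced; the definitions are `LSeries.shiftSeq`, `LSeries.bookerGen`,
`LSeries.bookerSpan` (real definitions with unfolding lemmas).

## References

* [Booker2003] A. R. Booker, *Poles of Artin L-functions and the strong Artin conjecture*, Ann.
  of Math. 158 (2003), 1089–1098: Lemma 1 p. 1092, proof pp. 1092–1093, eqs. (6)–(8).

## Mathlib / tree search

`lean search 'shiftSeq|bookerSpan|addTwistCoeff_mem'`: nothing; Mathlib has `LSeries`,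
`DirichletCharacter.mul`, `DirichletCharacter.sum_char_inv_mul_char_eq`, `ZMod.stdAddChar`,
`Nat.recOnPrimeCoprime`, but no additive twists and no shift operator on coefficient sequences.
-/

noncomputable section

open Finset Complex Filter

namespace Literature.NumberTheory.LFunctions

namespace LSeries

/-! ### Shifted sequences -/

/-- The **shift by `q`** of a coefficient sequence: `shiftSeq q f n = f (n / q)` if `q ∣ n` and `0`
otherwise — the coefficient sequence of the Dirichlet series `q^{-s} · ∑ f(n) n^{-s}`
(`LSeries_shiftSeq`); Booker's `q^{-s} L(s, ρ ⊗ χ₀)`.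
[cite: Booker2003, proof of Lemma 1 p. 1092] -/
def shiftSeq (q : ℕ) (f : ℕ → ℂ) : ℕ → ℂ := fun n => if q ∣ n then f (n / q) else 0

/-- Unfolding of `shiftSeq`. [folklore] -/
theorem shiftSeq_apply (q : ℕ) (f : ℕ → ℂ) (n : ℕ) :
    shiftSeq q f n = if q ∣ n then f (n / q) else 0 := rfl

/-- `shiftSeq q f (q m) = f m`. [folklore] -/
theorem shiftSeq_apply_mul {q : ℕ} (hq : q ≠ 0) (f : ℕ → ℂ) (m : ℕ) :
    shiftSeq q f (q * m) = f m := by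
  rw [shiftSeq_apply, if_pos (dvd_mul_right q m), Nat.mul_div_cancel_left m (Nat.pos_of_ne_zero hq)]

/-- `shiftSeq q f` vanishes off the multiples of `q`. [folklore] -/
theorem shiftSeq_apply_of_not_dvd {q n : ℕ} (h : ¬ q ∣ n) (f : ℕ → ℂ) : shiftSeq q f n = 0 := by
  rw [shiftSeq_apply, if_neg h]

/-- The shift by `1` is the identity. [folklore] -/
theorem shiftSeq_one (f : ℕ → ℂ) : shiftSeq 1 f = f := by
  funext n
  simp [shiftSeq]

/-- Shifts compose: shift by `q` then by `q'` is the shift by `q' q`. [folklore] -/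
theorem shiftSeq_shiftSeq (q q' : ℕ) (f : ℕ → ℂ) :
    shiftSeq q' (shiftSeq q f) = shiftSeq (q' * q) f := by
  funext n
  simp only [shiftSeq]
  by_cases h' : q' ∣ n
  · rw [if_pos h']
    by_cases h : q ∣ n / q'
    · rw [if_pos h, if_pos ((Nat.dvd_div_iff_mul_dvd h').1 h), Nat.div_div_eq_div_mul]
    · rw [if_neg h, if_neg (fun hh => h ((Nat.dvd_div_iff_mul_dvd h').2 hh))]
  · rw [if_neg h', if_neg (fun hh => h' (dvd_of_mul_right_dvd hh))]

/-- The shift is additive. [folklore] -/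
theorem shiftSeq_add (q : ℕ) (f g : ℕ → ℂ) : shiftSeq q (f + g) = shiftSeq q f + shiftSeq q g := by
  funext n
  simp only [shiftSeq, Pi.add_apply]
  split_ifs <;> simp

/-- The shift is homogeneous. [folklore] -/
theorem shiftSeq_smul (q : ℕ) (c : ℂ) (f : ℕ → ℂ) : shiftSeq q (c • f) = c • shiftSeq q f := by
  funext n
  simp only [shiftSeq, Pi.smul_apply, smul_eq_mul]
  split_ifs <;> simp

/-- The shift of `0` is `0`. [folklore] -/
theorem shiftSeq_zero (q : ℕ) : shiftSeq q (0 : ℕ → ℂ) = 0 := by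
  funext n
  simp [shiftSeq]

/-- The shift commutes with finite sums. [folklore] -/
theorem shiftSeq_sum {ι : Type*} (q : ℕ) (S : Finset ι) (F : ι → ℕ → ℂ) :
    shiftSeq q (∑ i ∈ S, F i) = ∑ i ∈ S, shiftSeq q (F i) := by
  classical
  induction S using Finset.induction_on with
  | empty => simp [shiftSeq_zero]
  | insert i S hi ih => rw [Finset.sum_insert hi, Finset.sum_insert hi, shiftSeq_add, ih]

/-- For a weight `w` multiplicative across `q` (`w(qm) = w(q) w(m)`, e.g. a Dirichlet character):
`shiftSeq q f · w = w(q) • shiftSeq q (f · w)`. [folklore] -/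
theorem shiftSeq_mul_of_map_mul {q : ℕ} (hq : q ≠ 0) (f w : ℕ → ℂ)
    (hw : ∀ m, w (q * m) = w q * w m) :
    shiftSeq q f * w = w q • shiftSeq q (f * w) := by
  funext n
  simp only [Pi.mul_apply, Pi.smul_apply, smul_eq_mul, shiftSeq]
  by_cases h : q ∣ n
  · rw [if_pos h, if_pos h]
    obtain ⟨m, rfl⟩ := h
    rw [Nat.mul_div_cancel_left m (Nat.pos_of_ne_zero hq), hw m]
    ring
  · rw [if_neg h, if_neg h]
    ring

/-! ### Additive twisting as an operation on sequences -/

/-- Twisting a shifted sequence: `shiftSeq q f` twisted by `y` is the shift of `f` twisted by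
`q y` (`e(q m y) = e(m (q y))`). [folklore] -/
theorem addTwistCoeff_shiftSeq {q : ℕ} (hq : q ≠ 0) (f : ℕ → ℂ) (y : ℚ) :
    addTwistCoeff (shiftSeq q f) y = shiftSeq q (addTwistCoeff f (q * y)) := by
  funext n
  simp only [addTwistCoeff, shiftSeq]
  by_cases h : q ∣ n
  · rw [if_pos h, if_pos h]
    obtain ⟨m, rfl⟩ := h
    rw [Nat.mul_div_cancel_left m (Nat.pos_of_ne_zero hq)]
    congr 2
    push_cast
    ring
  · rw [if_neg h, if_neg h, zero_mul]

/-- `e(n(y + z)) = e(ny) e(nz)`: twisting by `y + z` is twisting by `y`, then by `z`. [folklore] -/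
theorem addTwistCoeff_add_right (f : ℕ → ℂ) (y z : ℚ) :
    addTwistCoeff f (y + z) = addTwistCoeff (addTwistCoeff f y) z := by
  funext n
  simp only [addTwistCoeff]
  rw [mul_assoc (f n), ← Complex.exp_add]
  congr 2
  push_cast
  ring

/-- `e(nk) = 1` for an integer `k`: twisting by an integer does nothing. [folklore] -/
theorem addTwistCoeff_intCast (f : ℕ → ℂ) (k : ℤ) : addTwistCoeff f (k : ℚ) = f := by
  funext n
  simp only [addTwistCoeff]
  have : (2 * Real.pi * I * (n : ℂ) * (((k : ℚ)) : ℂ)) = ((n * k : ℤ) : ℂ) * (2 * Real.pi * I) := by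
    push_cast
    ring
  rw [this, Complex.exp_int_mul_two_pi_mul_I, mul_one]

/-- Twisting is additive in the sequence. [folklore] -/
theorem addTwistCoeff_add_left (f g : ℕ → ℂ) (y : ℚ) :
    addTwistCoeff (f + g) y = addTwistCoeff f y + addTwistCoeff g y := by
  funext n
  simp only [addTwistCoeff, Pi.add_apply]
  ring

/-- Twisting is homogeneous in the sequence. [folklore] -/
theorem addTwistCoeff_smul_left (c : ℂ) (f : ℕ → ℂ) (y : ℚ) :
    addTwistCoeff (c • f) y = c • addTwistCoeff f y := by
  funext n
  simp only [addTwistCoeff, Pi.smul_apply, smul_eq_mul]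
  ring

/-! ### Dirichlet characters as weights on `ℕ` -/

/-- Pointwise values on `ℕ` of the product `DirichletCharacter.mul χ χ'` (level `lcm M M'`) of two
Dirichlet characters of arbitrary levels: `(χχ')(n) = χ(n) χ'(n)` (both sides vanish unless `n` is
prime to `M` and `M'`). [folklore] -/
theorem dirichlet_mul_apply_natCast {M M' : ℕ} (χ : DirichletCharacter ℂ M)
    (χ' : DirichletCharacter ℂ M') (n : ℕ) :
    DirichletCharacter.mul χ χ' (n : ZMod (Nat.lcm M M')) = χ (n : ZMod M) * χ' (n : ZMod M') := by
  by_cases h : IsUnit (n : ZMod (Nat.lcm M M'))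
  · have hc : IsCoprime (n : ℤ) (Nat.lcm M M' : ℕ) := by
      rw [Int.isCoprime_iff_gcd_eq_one, Int.gcd_natCast_natCast]
      exact (ZMod.isUnit_iff_coprime _ _).1 h
    have h1 := DirichletCharacter.changeLevel_eq_cast_of_dvd' χ (Nat.dvd_lcm_left M M') hc
    have h2 := DirichletCharacter.changeLevel_eq_cast_of_dvd' χ' (Nat.dvd_lcm_right M M') hc
    simp only [Int.cast_natCast] at h1 h2
    rw [DirichletCharacter.mul, MulChar.mul_apply, h1, h2]
  · rw [MulChar.map_nonunit _ h]
    rw [ZMod.isUnit_iff_coprime] at h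
    by_cases h1 : Nat.Coprime n M
    · have h2 : ¬ Nat.Coprime n M' := fun h2 =>
        h (Nat.Coprime.coprime_dvd_right (Nat.lcm_dvd_mul M M') (Nat.Coprime.mul_right h1 h2))
      rw [MulChar.map_nonunit χ' (mt (ZMod.isUnit_iff_coprime _ _).1 h2), mul_zero]
    · rw [MulChar.map_nonunit χ (mt (ZMod.isUnit_iff_coprime _ _).1 h1), zero_mul]

/-- Dirichlet characters are completely multiplicative on `ℕ`. [folklore] -/
theorem dirichlet_apply_natCast_mul {M : ℕ} (χ : DirichletCharacter ℂ M) (m n : ℕ) :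
    χ ((m * n : ℕ) : ZMod M) = χ (m : ZMod M) * χ (n : ZMod M) := by
  rw [Nat.cast_mul, map_mul]

/-- A Dirichlet character of level `p ^ j`, `j ≠ 0`, vanishes on the multiples of `p`. [folklore] -/
theorem dirichlet_apply_prime_mul_eq_zero {p j : ℕ} (hp : p.Prime) (hj : j ≠ 0)
    (ψ : DirichletCharacter ℂ (p ^ j)) (t : ℕ) : ψ ((p * t : ℕ) : ZMod (p ^ j)) = 0 := by
  apply MulChar.map_nonunit
  rw [ZMod.isUnit_iff_coprime]
  intro hcop
  have h1 : Nat.Coprime p (p ^ j) := Nat.Coprime.coprime_dvd_left (dvd_mul_right p t) hcop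
  have h2 : p ∣ p ^ j := dvd_pow_self p hj
  have := Nat.Coprime.eq_one_of_dvd h1 h2
  exact hp.one_lt.ne' this

/-! ### Finite Fourier inversion on `(ℤ/N)ˣ` -/

/-- **Finite Fourier inversion on the units** ("by Fourier analysis, the exponential may be written
as a combination `∑ c_χ χ(r)` of characters `χ` to modulus `p^{m-k}`, including imprimitive
ones"): for a unit `b` of `ℤ/N`,
`∑_ψ [φ(N)⁻¹ ∑_{u ∈ (ℤ/N)ˣ} e(uc/N) ψ(u⁻¹)] ψ(b) = e(bc/N)` (`ZMod.stdAddChar`), by the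
orthogonality relation `∑_ψ ψ(a⁻¹) ψ(b) = φ(N) [a = b]`
(Mathlib `DirichletCharacter.sum_char_inv_mul_char_eq`; `ℂ` has enough roots of unity).
[cite: Booker2003, proof of Lemma 1 p. 1093] -/
theorem sum_fourierCoef_mul_apply {N : ℕ} [NeZero N] (c : ℤ) {b : ZMod N} (hb : IsUnit b) :
    ∑ ψ : DirichletCharacter ℂ N,
      (((N.totient : ℂ))⁻¹ *
        ∑ u : (ZMod N)ˣ, ZMod.stdAddChar ((u : ZMod N) * (c : ZMod N)) * ψ ((u : ZMod N)⁻¹)) *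
        ψ b =
      ZMod.stdAddChar (b * (c : ZMod N)) := by
  have hφ : (N.totient : ℂ) ≠ 0 := by
    exact_mod_cast (Nat.totient_pos.mpr (NeZero.pos N)).ne'
  calc ∑ ψ : DirichletCharacter ℂ N,
      (((N.totient : ℂ))⁻¹ *
        ∑ u : (ZMod N)ˣ, ZMod.stdAddChar ((u : ZMod N) * (c : ZMod N)) * ψ ((u : ZMod N)⁻¹)) *
        ψ b
      = ((N.totient : ℂ))⁻¹ * ∑ u : (ZMod N)ˣ, ZMod.stdAddChar ((u : ZMod N) * (c : ZMod N)) *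
          ∑ ψ : DirichletCharacter ℂ N, ψ ((u : ZMod N)⁻¹) * ψ b := by
        simp_rw [Finset.mul_sum, Finset.sum_mul]
        rw [Finset.sum_comm]
        refine Finset.sum_congr rfl fun u _ => Finset.sum_congr rfl fun ψ _ => ?_
        ring
    _ = ((N.totient : ℂ))⁻¹ * ∑ u : (ZMod N)ˣ, ZMod.stdAddChar ((u : ZMod N) * (c : ZMod N)) *
          (if (u : ZMod N) = b then (N.totient : ℂ) else 0) := by
        congr 1
        refine Finset.sum_congr rfl fun u _ => ?_
        rw [DirichletCharacter.sum_char_inv_mul_char_eq ℂ (Units.isUnit u) b]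
    _ = ((N.totient : ℂ))⁻¹ *
          (ZMod.stdAddChar ((hb.unit : ZMod N) * (c : ZMod N)) * (N.totient : ℂ)) := by
        congr 1
        rw [Finset.sum_eq_single hb.unit]
        · rw [if_pos hb.unit_spec]
        · intro u _ hu
          have hne : (u : ZMod N) ≠ b := fun hu' =>
            hu (Units.ext (hu'.trans hb.unit_spec.symm))
          rw [if_neg hne, mul_zero]
        · intro h
          exact absurd (Finset.mem_univ _) h
    _ = ZMod.stdAddChar (b * (c : ZMod N)) := by
        rw [hb.unit_spec]
        field_simp

/-- Existence of Fourier coefficients `coef k ψ` (for every `k < m`) expressing `r ↦ e(rc/p^{m-k})`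
on the integers `r` prime to `p` through the Dirichlet characters `ψ` mod `p^{m-k}`:
`∑_ψ coef k ψ · ψ(r) = e(rc/p^{m-k})`. [cite: Booker2003, proof of Lemma 1 p. 1093] -/
theorem exists_fourierCoef {p : ℕ} [NeZero p] (hp : p.Prime) (m : ℕ) (c : ℤ) :
    ∃ coef : (k : ℕ) → DirichletCharacter ℂ (p ^ (m - k)) → ℂ,
      ∀ k < m, ∀ r : ℕ, ¬ p ∣ r →
        ∑ ψ : DirichletCharacter ℂ (p ^ (m - k)), coef k ψ * ψ (r : ZMod (p ^ (m - k))) =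
          ZMod.stdAddChar (((r : ℕ) : ZMod (p ^ (m - k))) * (c : ZMod (p ^ (m - k)))) := by
  refine ⟨fun k ψ => (((p ^ (m - k)).totient : ℂ))⁻¹ *
    ∑ u : (ZMod (p ^ (m - k)))ˣ, ZMod.stdAddChar ((u : ZMod (p ^ (m - k))) *
      (c : ZMod (p ^ (m - k)))) * ψ ((u : ZMod (p ^ (m - k)))⁻¹), fun k _ r hr => ?_⟩
  have hunit : IsUnit ((r : ℕ) : ZMod (p ^ (m - k))) :=
    (ZMod.isUnit_iff_coprime r _).2 (Nat.Coprime.pow_right _ (hp.coprime_iff_not_dvd.2 hr).symm)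
  exact sum_fourierCoef_mul_apply c hunit

/-! ### The key identity: twisting a multiplicative sequence by `c / p ^ m` -/

/-- Evaluation of a shifted weighted sequence at `n = p^{k₀} r`, `p ∤ r`, for a weight `w`
vanishing on the multiples of `p` ("writing `n = p^k r` with `(r, p) = 1`"):
`shiftSeq p^k (b · w) (p^{k₀} r) = b(r) w(r)` if `k = k₀` and `0` otherwise.
[cite: Booker2003, proof of Lemma 1, eq. (7) p. 1093] -/
theorem shiftSeq_pow_mul_weight_apply {b : ℕ → ℂ} {p : ℕ} (hp : p.Prime)
    {w : ℕ → ℂ} (hw : ∀ t, w (p * t) = 0) {k₀ r : ℕ} (hr : ¬ p ∣ r) (k : ℕ) :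
    shiftSeq (p ^ k) (b * w) (p ^ k₀ * r) = if k = k₀ then b r * w r else 0 := by
  have hp0 : 0 < p := hp.pos
  by_cases hk : k ≤ k₀
  · have hdvd : p ^ k ∣ p ^ k₀ * r := Dvd.dvd.mul_right (pow_dvd_pow p hk) r
    rw [shiftSeq_apply, if_pos hdvd, Pi.mul_apply]
    have hq : p ^ k₀ * r / p ^ k = p ^ (k₀ - k) * r := by
      rw [mul_comm, Nat.mul_div_assoc r (pow_dvd_pow p hk), Nat.pow_div hk hp0, mul_comm]
    rw [hq]
    rcases eq_or_lt_of_le hk with rfl | hlt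
    · simp
    · have hne : k ≠ k₀ := hlt.ne
      rw [if_neg hne]
      have : p ^ (k₀ - k) * r = p * (p ^ (k₀ - k - 1) * r) := by
        rw [← mul_assoc, ← pow_succ']
        congr 2
        omega
      rw [this, hw, mul_zero]
  · have hne : k ≠ k₀ := fun h => hk h.le
    have hndvd : ¬ p ^ k ∣ p ^ k₀ * r := by
      intro hdvd
      apply hk
      have hcop : Nat.Coprime (p ^ k) r := Nat.Coprime.pow_left k (hp.coprime_iff_not_dvd.2 hr)
      have h1 : p ^ k ∣ p ^ k₀ := hcop.dvd_mul_right.1 hdvd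
      exact (Nat.pow_dvd_pow_iff_le_right hp.one_lt).1 h1
    rw [if_neg hne, shiftSeq_apply, if_neg hndvd]

/-- **Booker 2003, proof of Lemma 1, eqs. (6)–(8): the twist of a multiplicative sequence by
`e(nc/p^m)`.**  Let `b : ℕ → ℂ` be multiplicative on coprime arguments with `b 0 = 0`, `p` prime,
`m ≥ 0`, `c ∈ ℤ`, and let `coef k ψ` (`k < m`, `ψ` mod `p^{m-k}`) be Fourier coefficients with
`∑_ψ coef k ψ · ψ(r) = e(rc/p^{m-k})` for `p ∤ r` (`exists_fourierCoef`). Then, as sequences,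
`b(n) e(nc/p^m) = b(n) - ∑_{k<m} b(p^k) · [shiftSeq p^k (b · 𝟙_p)](n)
  + ∑_{k<m} b(p^k) · [shiftSeq p^k (∑_ψ coef k ψ · (b · ψ))](n)`,
`𝟙_p` the trivial character mod `p` (printed, eq. (7): `∑ₙ bₙ e(-cn/p^m) n^{-s} =
∑_{k<m} b_{p^k} p^{-ks} ∑_{(r,p)=1} b_r e(-cr/p^{m-k}) r^{-s} + ∑_{k≥m} b_{p^k} p^{-ks} ∑_{(r,p)=1} b_r r^{-s}`;
here the tail `k ≥ m` is written as `b` minus the terms `k < m`, and the exponential is expanded in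
the characters mod `p^{m-k}` as in eq. (8); the naive twists `b · ψ` replace Booker's
`L(s, ρ ⊗ χ₀ ⊗ χ)` with its Euler factor at `p` removed).
[cite: Booker2003, proof of Lemma 1, eqs. (6)–(8) pp. 1092–1093] -/
theorem addTwistCoeff_primePow_eq (b : ℕ → ℂ) (hb0 : b 0 = 0)
    (hmul : ∀ m n, Nat.Coprime m n → b (m * n) = b m * b n) {p : ℕ} [NeZero p] (hp : p.Prime)
    (m : ℕ) (c : ℤ) (coef : (k : ℕ) → DirichletCharacter ℂ (p ^ (m - k)) → ℂ)
    (hcoef : ∀ k < m, ∀ r : ℕ, ¬ p ∣ r →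
        ∑ ψ : DirichletCharacter ℂ (p ^ (m - k)), coef k ψ * ψ (r : ZMod (p ^ (m - k))) =
          ZMod.stdAddChar (((r : ℕ) : ZMod (p ^ (m - k))) * (c : ZMod (p ^ (m - k))))) :
    addTwistCoeff b ((c : ℚ) / (p : ℚ) ^ m) =
      b - ∑ k ∈ Finset.range m,
            b (p ^ k) • shiftSeq (p ^ k) (b * fun n : ℕ => (1 : DirichletCharacter ℂ p) (n : ZMod p))
        + ∑ k ∈ Finset.range m, b (p ^ k) • shiftSeq (p ^ k)
            (∑ ψ : DirichletCharacter ℂ (p ^ (m - k)),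
              coef k ψ • (b * fun n : ℕ => ψ (n : ZMod (p ^ (m - k))))) := by
  haveI : Fact p.Prime := ⟨hp⟩
  have hp0 : (p : ℂ) ≠ 0 := by exact_mod_cast hp.ne_zero
  -- the weights vanish on the multiples of `p`
  have hw1 : ∀ t : ℕ, (1 : DirichletCharacter ℂ p) ((p * t : ℕ) : ZMod p) = 0 := by
    intro t
    rw [Nat.cast_mul, ZMod.natCast_self, zero_mul]
    exact MulChar.map_zero _
  have hwψ : ∀ k ∈ Finset.range m, ∀ (ψ : DirichletCharacter ℂ (p ^ (m - k))) (t : ℕ),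
      ψ ((p * t : ℕ) : ZMod (p ^ (m - k))) = 0 := by
    intro k hk ψ t
    have hj : m - k ≠ 0 := by
      have := Finset.mem_range.1 hk
      omega
    exact dirichlet_apply_prime_mul_eq_zero hp hj ψ t
  funext n
  simp only [Pi.add_apply, Pi.sub_apply, Finset.sum_apply, Pi.smul_apply, smul_eq_mul]
  rcases eq_or_ne n 0 with rfl | hn
  · -- `n = 0`: everything vanishes since `b 0 = 0`
    have h0 : ∀ (q : ℕ) (g : ℕ → ℂ), shiftSeq q g 0 = g 0 := fun q g => by
      simp [shiftSeq]
    simp [addTwistCoeff_apply, h0, hb0]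
  · -- `n = p ^ k₀ * r` with `p ∤ r`
    obtain ⟨k₀, r, hr, rfl⟩ := Nat.exists_eq_pow_mul_and_not_dvd hn p hp.ne_one
    have hbn : b (p ^ k₀ * r) = b (p ^ k₀) * b r :=
      hmul _ _ (Nat.Coprime.pow_left k₀ (hp.coprime_iff_not_dvd.2 hr))
    have hunit_r : IsUnit ((r : ℕ) : ZMod p) :=
      (ZMod.isUnit_iff_coprime r p).2 ((hp.coprime_iff_not_dvd.2 hr).symm)
    have h1r : (1 : DirichletCharacter ℂ p) (r : ZMod p) = 1 := MulChar.one_apply hunit_r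
    -- the tail term `∑_{k<m} b(p^k) shiftSeq p^k (b 𝟙_p)` at `n`
    have hA : ∀ k, shiftSeq (p ^ k) (b * fun n : ℕ => (1 : DirichletCharacter ℂ p) (n : ZMod p))
        (p ^ k₀ * r) = if k = k₀ then b r * (1 : DirichletCharacter ℂ p) (r : ZMod p) else 0 :=
      fun k => shiftSeq_pow_mul_weight_apply hp
        (w := fun n : ℕ => (1 : DirichletCharacter ℂ p) (n : ZMod p)) hw1 hr k
    have hT2 : ∑ k ∈ Finset.range m, b (p ^ k) *
        shiftSeq (p ^ k) (b * fun n : ℕ => (1 : DirichletCharacter ℂ p) (n : ZMod p))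
          (p ^ k₀ * r) = if k₀ < m then b (p ^ k₀ * r) else 0 := by
      simp_rw [hA, h1r, mul_one, mul_ite, mul_zero]
      rw [Finset.sum_ite_eq']
      by_cases hk₀ : k₀ < m
      · rw [if_pos (Finset.mem_range.2 hk₀), if_pos hk₀, hbn]
      · rw [if_neg (fun h => hk₀ (Finset.mem_range.1 h)), if_neg hk₀]
    -- the character term at `n`
    have hB : ∀ k ∈ Finset.range m,
        shiftSeq (p ^ k) (∑ ψ : DirichletCharacter ℂ (p ^ (m - k)),
          coef k ψ • (b * fun n : ℕ => ψ (n : ZMod (p ^ (m - k))))) (p ^ k₀ * r) =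
        if k = k₀ then b r *
          ZMod.stdAddChar (((r : ℕ) : ZMod (p ^ (m - k))) * (c : ZMod (p ^ (m - k)))) else 0 := by
      intro k hk
      rw [shiftSeq_sum, Finset.sum_apply]
      simp_rw [shiftSeq_smul, Pi.smul_apply, smul_eq_mul]
      have hψ : ∀ ψ : DirichletCharacter ℂ (p ^ (m - k)),
          shiftSeq (p ^ k) (b * fun n : ℕ => ψ (n : ZMod (p ^ (m - k)))) (p ^ k₀ * r) =
            if k = k₀ then b r * ψ (r : ZMod (p ^ (m - k))) else 0 :=
        fun ψ => shiftSeq_pow_mul_weight_apply hp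
          (w := fun n : ℕ => ψ (n : ZMod (p ^ (m - k)))) (hwψ k hk ψ) hr k
      simp_rw [hψ]
      by_cases hkk : k = k₀
      · rw [if_pos hkk]
        simp_rw [if_pos hkk]
        rw [← hcoef k (Finset.mem_range.1 hk) r hr, Finset.mul_sum]
        refine Finset.sum_congr rfl fun ψ _ => ?_
        ring
      · rw [if_neg hkk]
        simp_rw [if_neg hkk, mul_zero]
        exact Finset.sum_const_zero
    have hT3 : ∑ k ∈ Finset.range m, b (p ^ k) *
        shiftSeq (p ^ k) (∑ ψ : DirichletCharacter ℂ (p ^ (m - k)),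
          coef k ψ • (b * fun n : ℕ => ψ (n : ZMod (p ^ (m - k))))) (p ^ k₀ * r) =
        if k₀ < m then b (p ^ k₀ * r) *
          Complex.exp (2 * Real.pi * I * ((p ^ k₀ * r : ℕ) : ℂ) *
            ((((c : ℚ) / (p : ℚ) ^ m : ℚ)) : ℂ)) else 0 := by
      have step : ∑ k ∈ Finset.range m, b (p ^ k) *
          shiftSeq (p ^ k) (∑ ψ : DirichletCharacter ℂ (p ^ (m - k)),
            coef k ψ • (b * fun n : ℕ => ψ (n : ZMod (p ^ (m - k))))) (p ^ k₀ * r) =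
          ∑ k ∈ Finset.range m, b (p ^ k) * (if k = k₀ then b r *
            ZMod.stdAddChar (((r : ℕ) : ZMod (p ^ (m - k))) * (c : ZMod (p ^ (m - k)))) else 0) :=
        Finset.sum_congr rfl fun k hk => by rw [hB k hk]
      rw [step]
      simp_rw [mul_ite, mul_zero]
      rw [Finset.sum_ite_eq']
      by_cases hk₀ : k₀ < m
      · rw [if_pos (Finset.mem_range.2 hk₀), if_pos hk₀, hbn]
        -- identify the exponentials: `e(rc/p^{m-k₀}) = e(nc/p^m)` for `n = p^{k₀} r`
        have hexp : ZMod.stdAddChar (((r : ℕ) : ZMod (p ^ (m - k₀))) * (c : ZMod (p ^ (m - k₀)))) =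
            Complex.exp (2 * Real.pi * I * ((p ^ k₀ * r : ℕ) : ℂ) *
              ((((c : ℚ) / (p : ℚ) ^ m : ℚ)) : ℂ)) := by
          have : (((r : ℕ) : ZMod (p ^ (m - k₀))) * (c : ZMod (p ^ (m - k₀)))) =
              ((r * c : ℤ) : ZMod (p ^ (m - k₀))) := by
            push_cast
            ring
          rw [this, ZMod.stdAddChar_coe]
          congr 1
          obtain ⟨j, hj⟩ : ∃ j, m = k₀ + j := ⟨m - k₀, by omega⟩
          have hj' : m - k₀ = j := by omega
          rw [hj', hj, pow_add]
          push_cast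
          field_simp
        rw [hexp]
        ring
      · rw [if_neg (fun h => hk₀ (Finset.mem_range.1 h)), if_neg hk₀]
    rw [hT2, hT3, addTwistCoeff_apply]
    by_cases hk₀ : k₀ < m
    · rw [if_pos hk₀, if_pos hk₀]
      ring
    · rw [if_neg hk₀, if_neg hk₀, sub_zero, add_zero]
      -- `p^m ∣ n`, so the exponential is `1`
      have : (2 * Real.pi * I * ((p ^ k₀ * r : ℕ) : ℂ) * ((((c : ℚ) / (p : ℚ) ^ m : ℚ)) : ℂ)) =
          ((p ^ (k₀ - m) * r * c : ℤ) : ℂ) * (2 * Real.pi * I) := by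
        obtain ⟨j, hj⟩ : ∃ j, k₀ = m + j := ⟨k₀ - m, by omega⟩
        have hj' : k₀ - m = j := by omega
        rw [hj', hj, pow_add]
        push_cast
        field_simp
      rw [this, Complex.exp_int_mul_two_pi_mul_I, mul_one]

/-! ### Booker's span `V` -/

/-- The generators of Booker's span: the sequences `shiftSeq q (a · χ)`, `q ≥ 1`, `χ` a Dirichlet
character of level `M ≥ 1` (coefficient sequences of `q^{-s} ∑ a(n) χ(n) n^{-s}`; Booker's
`q^{-s} L(s, ρ ⊗ χ₀)`, here with naive, possibly imprimitive, twists).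
[cite: Booker2003, proof of Lemma 1 p. 1092] -/
def bookerGen (a : ℕ → ℂ) : Set (ℕ → ℂ) :=
  {f | ∃ (q M : ℕ) (χ : DirichletCharacter ℂ M), q ≠ 0 ∧ M ≠ 0 ∧
    f = shiftSeq q (a * fun n : ℕ => χ (n : ZMod M))}

/-- **Booker's space `V`** ("the vector space of Dirichlet series spanned by `q^{-s} L(s, ρ ⊗ χ₀)`
for positive integers `q` and Dirichlet characters `χ₀`"), on the level of coefficient sequences:
the `ℂ`-span of `bookerGen a`. [cite: Booker2003, proof of Lemma 1 p. 1092] -/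
def bookerSpan (a : ℕ → ℂ) : Submodule ℂ (ℕ → ℂ) := Submodule.span ℂ (bookerGen a)

/-- Unfolding of `bookerGen`. [folklore] -/
theorem mem_bookerGen_iff (a f : ℕ → ℂ) :
    f ∈ bookerGen a ↔ ∃ (q M : ℕ) (χ : DirichletCharacter ℂ M), q ≠ 0 ∧ M ≠ 0 ∧
      f = shiftSeq q (a * fun n : ℕ => χ (n : ZMod M)) :=
  Iff.rfl

/-- Unfolding of `bookerSpan`. [folklore] -/
theorem bookerSpan_eq (a : ℕ → ℂ) : bookerSpan a = Submodule.span ℂ (bookerGen a) := rfl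

variable (a : ℕ → ℂ)

/-- The generators lie in the span. [folklore] -/
theorem gen_mem_bookerSpan {q M : ℕ} (hq : q ≠ 0) (hM : M ≠ 0) (χ : DirichletCharacter ℂ M) :
    shiftSeq q (a * fun n : ℕ => χ (n : ZMod M)) ∈ bookerSpan a :=
  Submodule.subset_span ⟨q, M, χ, hq, hM, rfl⟩

/-- The character twists `a · χ` lie in the span (`q = 1`). [folklore] -/
theorem mul_char_mem_bookerSpan {M : ℕ} (hM : M ≠ 0) (χ : DirichletCharacter ℂ M) :
    (a * fun n : ℕ => χ (n : ZMod M)) ∈ bookerSpan a := by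
  have := gen_mem_bookerSpan a one_ne_zero hM χ
  rwa [shiftSeq_one] at this

/-- `a` itself lies in the span ("clearly `L(s, ρ) ∈ V`": twist by the trivial character mod `1`).
[cite: Booker2003, proof of Lemma 1 p. 1092] -/
theorem self_mem_bookerSpan : a ∈ bookerSpan a := by
  have h := mul_char_mem_bookerSpan a one_ne_zero (1 : DirichletCharacter ℂ 1)
  haveI : Subsingleton (ZMod 1) := ZMod.subsingleton_iff.2 rfl
  have : (a * fun n : ℕ => (1 : DirichletCharacter ℂ 1) (n : ZMod 1)) = a := by
    funext n
    simp only [Pi.mul_apply]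
    rw [MulChar.one_apply (isUnit_of_subsingleton _), mul_one]
  rwa [this] at h

/-- A linear operator mapping the generators into the span maps the span into itself. [folklore] -/
theorem map_mem_bookerSpan {T : (ℕ → ℂ) →ₗ[ℂ] (ℕ → ℂ)}
    (h : ∀ f ∈ bookerGen a, T f ∈ bookerSpan a) {f : ℕ → ℂ} (hf : f ∈ bookerSpan a) :
    T f ∈ bookerSpan a := by
  have hle : Submodule.span ℂ (bookerGen a) ≤ (bookerSpan a).comap T :=
    Submodule.span_le.2 fun g hg => Submodule.mem_comap.2 (h g hg)
  exact Submodule.mem_comap.1 (hle hf)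

/-- The span is stable under the shifts `shiftSeq q`, `q ≥ 1`. [cite: Booker2003, proof of Lemma 1 p. 1092] -/
theorem shiftSeq_mem_bookerSpan {q : ℕ} (hq : q ≠ 0) {f : ℕ → ℂ} (hf : f ∈ bookerSpan a) :
    shiftSeq q f ∈ bookerSpan a := by
  let T : (ℕ → ℂ) →ₗ[ℂ] (ℕ → ℂ) :=
    { toFun := shiftSeq q, map_add' := shiftSeq_add q, map_smul' := shiftSeq_smul q }
  have hT : ∀ g, T g = shiftSeq q g := fun g => rfl
  rw [← hT]
  refine map_mem_bookerSpan a (T := T) (fun g hg => ?_) hf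
  obtain ⟨q', M, χ, hq', hM, rfl⟩ := hg
  rw [hT, shiftSeq_shiftSeq]
  exact gen_mem_bookerSpan a (mul_ne_zero hq hq') hM χ

/-- The span is stable under multiplication by Dirichlet characters (of any level `M' ≥ 1`): a
generator `shiftSeq q (a χ)` times `χ'` is `χ'(q) · shiftSeq q (a χχ')`.
[cite: Booker2003, proof of Lemma 1 p. 1093] -/
theorem mul_char_mem_bookerSpan_of_mem {M' : ℕ} (hM' : M' ≠ 0) (χ' : DirichletCharacter ℂ M')
    {f : ℕ → ℂ} (hf : f ∈ bookerSpan a) :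
    (f * fun n : ℕ => χ' (n : ZMod M')) ∈ bookerSpan a := by
  have hgen : ∀ g ∈ bookerGen a,
      LinearMap.mulRight ℂ (fun n : ℕ => χ' (n : ZMod M')) g ∈ bookerSpan a := by
    intro g hg
    obtain ⟨q, M, χ, hq, hM, rfl⟩ := hg
    rw [LinearMap.mulRight_apply,
      shiftSeq_mul_of_map_mul hq _ _ (fun t => dirichlet_apply_natCast_mul χ' q t)]
    refine Submodule.smul_mem _ _ ?_
    have : ((a * fun n : ℕ => χ (n : ZMod M)) * fun n : ℕ => χ' (n : ZMod M')) =
        a * fun n : ℕ => DirichletCharacter.mul χ χ' (n : ZMod (Nat.lcm M M')) := by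
      funext n
      simp only [Pi.mul_apply]
      rw [dirichlet_mul_apply_natCast, mul_assoc]
    rw [this]
    exact gen_mem_bookerSpan a hq (Nat.lcm_ne_zero hM hM') _
  have key := map_mem_bookerSpan a hgen hf
  rwa [LinearMap.mulRight_apply] at key

/-- A character twist `b · χ` of a coprime-multiplicative `b` is coprime-multiplicative. [folklore] -/
theorem coprime_mul_of_mul_char {b : ℕ → ℂ}
    (hmul : ∀ m n, Nat.Coprime m n → b (m * n) = b m * b n) {M : ℕ} (χ : DirichletCharacter ℂ M) :
    ∀ m n, Nat.Coprime m n →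
      (b * fun n : ℕ => χ (n : ZMod M)) (m * n) =
        (b * fun n : ℕ => χ (n : ZMod M)) m * (b * fun n : ℕ => χ (n : ZMod M)) n := by
  intro m n hmn
  simp only [Pi.mul_apply]
  rw [hmul m n hmn, dirichlet_apply_natCast_mul]
  ring

/-- **Stability of `V` under the twists by `c/p^m`** ("it suffices to show that `V` is stable under
such twists"): for coprime-multiplicative `a` with `a 0 = 0`, `p` prime, `m ≥ 0`, `c ∈ ℤ`, the
twist by `c/p^m` maps `bookerSpan a` into itself — on a generator `shiftSeq q (aχ)` it is the shift
of the twist of the coprime-multiplicative `aχ` by `qc/p^m`, which `addTwistCoeff_primePow_eq`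
writes in terms of shifts of `aχ𝟙_p` and `aχψ`. [cite: Booker2003, proof of Lemma 1 pp. 1092–1093] -/
theorem addTwistCoeff_primePow_mem_bookerSpan (ha0 : a 0 = 0)
    (hmul : ∀ m n, Nat.Coprime m n → a (m * n) = a m * a n) {p : ℕ} (hp : p.Prime) (m : ℕ)
    (c : ℤ) {f : ℕ → ℂ} (hf : f ∈ bookerSpan a) :
    addTwistCoeff f ((c : ℚ) / (p : ℚ) ^ m) ∈ bookerSpan a := by
  haveI : NeZero p := ⟨hp.ne_zero⟩
  let T : (ℕ → ℂ) →ₗ[ℂ] (ℕ → ℂ) :=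
    { toFun := fun g => addTwistCoeff g ((c : ℚ) / (p : ℚ) ^ m)
      map_add' := fun g g' => addTwistCoeff_add_left g g' _
      map_smul' := fun r g => addTwistCoeff_smul_left r g _ }
  have hT : ∀ g, T g = addTwistCoeff g ((c : ℚ) / (p : ℚ) ^ m) := fun g => rfl
  rw [← hT]
  refine map_mem_bookerSpan a (T := T) (fun g hg => ?_) hf
  obtain ⟨q, M, χ, hq, hM, rfl⟩ := hg
  rw [hT, addTwistCoeff_shiftSeq hq]
  refine shiftSeq_mem_bookerSpan a hq ?_
  have hrat : (q : ℚ) * ((c : ℚ) / (p : ℚ) ^ m) = ((q * c : ℤ) : ℚ) / (p : ℚ) ^ m := by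
    push_cast
    ring
  obtain ⟨coef, hcoef⟩ := exists_fourierCoef hp m (q * c)
  have hb0 : (a * fun n : ℕ => χ (n : ZMod M)) 0 = 0 := by simp [ha0]
  rw [hrat, addTwistCoeff_primePow_eq _ hb0 (coprime_mul_of_mul_char hmul χ) hp m (q * c) coef hcoef]
  have hb : (a * fun n : ℕ => χ (n : ZMod M)) ∈ bookerSpan a := mul_char_mem_bookerSpan a hM χ
  refine Submodule.add_mem _ (Submodule.sub_mem _ hb ?_) ?_
  · refine Submodule.sum_mem _ fun k _ => Submodule.smul_mem _ _ ?_
    exact shiftSeq_mem_bookerSpan a (pow_ne_zero k hp.ne_zero)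
      (mul_char_mem_bookerSpan_of_mem a hp.ne_zero _ hb)
  · refine Submodule.sum_mem _ fun k _ => Submodule.smul_mem _ _ ?_
    refine shiftSeq_mem_bookerSpan a (pow_ne_zero k hp.ne_zero) ?_
    refine Submodule.sum_mem _ fun ψ _ => Submodule.smul_mem _ _ ?_
    exact mul_char_mem_bookerSpan_of_mem a (pow_ne_zero _ hp.ne_zero) ψ hb

/-- **Stability of `V` under the twists by `c/N` for every `N`** ("by the Chinese remainder theorem,
the additive twist by `α` can be built out of twists by `c/p^m` for `p` prime"): induction over
the factorisation of `N` into coprime prime powers (`Nat.recOnPrimeCoprime`), splitting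
`c/(AB) = c·v/A + c·u/B` from Bézout `Au + Bv = 1` (`Nat.gcd_eq_gcd_ab`) and twisting successively
(`addTwistCoeff_add_right`). [cite: Booker2003, proof of Lemma 1 p. 1092] -/
theorem addTwistCoeff_div_mem_bookerSpan (ha0 : a 0 = 0)
    (hmul : ∀ m n, Nat.Coprime m n → a (m * n) = a m * a n) (N : ℕ) :
    ∀ (c : ℤ) {f : ℕ → ℂ}, f ∈ bookerSpan a →
      addTwistCoeff f ((c : ℚ) / (N : ℚ)) ∈ bookerSpan a := by
  induction N using Nat.recOnPrimeCoprime with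
  | zero =>
    intro c f hf
    simpa using hf
  | prime_pow p k hp =>
    intro c f hf
    have := addTwistCoeff_primePow_mem_bookerSpan a ha0 hmul hp k c hf
    simpa using this
  | coprime A B hA hB hAB ihA ihB =>
    intro c f hf
    have hA0 : (A : ℚ) ≠ 0 := by exact_mod_cast (zero_lt_one.trans hA).ne'
    have hB0 : (B : ℚ) ≠ 0 := by exact_mod_cast (zero_lt_one.trans hB).ne'
    have hbez : (A : ℚ) * (Nat.gcdA A B : ℚ) + (B : ℚ) * (Nat.gcdB A B : ℚ) = 1 := by
      have h := Nat.gcd_eq_gcd_ab A B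
      rw [Nat.Coprime.gcd_eq_one hAB] at h
      exact_mod_cast h.symm
    have hsplit : ((c : ℚ) / ((A * B : ℕ) : ℚ)) =
        ((c * Nat.gcdB A B : ℤ) : ℚ) / (A : ℚ) + ((c * Nat.gcdA A B : ℤ) : ℚ) / (B : ℚ) := by
      rw [div_add_div _ _ hA0 hB0, Nat.cast_mul,
        div_eq_div_iff (mul_ne_zero hA0 hB0) (mul_ne_zero hA0 hB0)]
      push_cast
      linear_combination (-((A : ℚ) * (B : ℚ) * (c : ℚ))) * hbez
    rw [hsplit, addTwistCoeff_add_right]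
    exact ihB _ (ihA _ hf)

/-- **Booker 2003, proof of Lemma 1 — the algebraic core: `L(s, ρ, α) ∈ V`.**  For a sequence
`a : ℕ → ℂ` multiplicative on coprime arguments with `a 0 = 0` and a rational `x`, the additively
twisted sequence `n ↦ a(n) e(nx)` (`addTwistCoeff a x`) lies in the `ℂ`-span of the shifted
character twists `shiftSeq q (a · χ)`, `q ≥ 1`, `χ` a Dirichlet character of level `≥ 1`.
[cite: Booker2003, proof of Lemma 1 pp. 1092–1093] -/
theorem addTwistCoeff_mem_bookerSpan (ha0 : a 0 = 0)
    (hmul : ∀ m n, Nat.Coprime m n → a (m * n) = a m * a n) (x : ℚ) :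
    addTwistCoeff a x ∈ bookerSpan a := by
  have h := addTwistCoeff_div_mem_bookerSpan a ha0 hmul x.den x.num (self_mem_bookerSpan a)
  rwa [Rat.num_div_den x] at h

/-- Finite-combination form of `addTwistCoeff_mem_bookerSpan`: `a(n) e(nx) = ∑ᵢ cᵢ ·
[shiftSeq qᵢ (a · χᵢ)](n)` for finitely many `cᵢ ∈ ℂ`, `qᵢ ≥ 1`, `χᵢ` mod `Mᵢ ≥ 1`.
[cite: Booker2003, proof of Lemma 1 pp. 1092–1093] -/
theorem exists_addTwistCoeff_eq_sum (ha0 : a 0 = 0)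
    (hmul : ∀ m n, Nat.Coprime m n → a (m * n) = a m * a n) (x : ℚ) :
    ∃ (ι : Type) (_ : Fintype ι) (c : ι → ℂ) (q : ι → ℕ) (M : ι → ℕ)
      (χ : (i : ι) → DirichletCharacter ℂ (M i)),
      (∀ i, q i ≠ 0) ∧ (∀ i, M i ≠ 0) ∧
      addTwistCoeff a x = ∑ i, c i • shiftSeq (q i) (a * fun n : ℕ => χ i (n : ZMod (M i))) := by
  obtain ⟨n, c, g, hg⟩ := Submodule.mem_span_set'.1 (addTwistCoeff_mem_bookerSpan a ha0 hmul x)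
  have hg' : ∀ i, ∃ (q M : ℕ) (χ : DirichletCharacter ℂ M), q ≠ 0 ∧ M ≠ 0 ∧
      (g i : ℕ → ℂ) = shiftSeq q (a * fun n : ℕ => χ (n : ZMod M)) := fun i => (g i).2
  choose q M χ hq hM hqM using hg'
  refine ⟨Fin n, inferInstance, c, q, M, χ, hq, hM, ?_⟩
  rw [← hg]
  exact Finset.sum_congr rfl fun i _ => by rw [hqM i]

/-! ### Passing to Dirichlet series -/

/-- The terms of the Dirichlet series of a shifted sequence: at `n = qm`,
`term (shiftSeq q f) s (qm) = q^{-s} · term f s m`. [folklore] -/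
theorem term_shiftSeq_mul {q : ℕ} (hq : q ≠ 0) (f : ℕ → ℂ) (s : ℂ) (m : ℕ) :
    LSeries.term (shiftSeq q f) s (q * m) = (q : ℂ) ^ (-s) * LSeries.term f s m := by
  rcases eq_or_ne m 0 with rfl | hm
  · simp [LSeries.term_zero]
  · have hq0 : (q : ℂ) ≠ 0 := by exact_mod_cast hq
    have hqs : (q : ℂ) ^ s ≠ 0 := fun h => hq0 ((Complex.cpow_eq_zero_iff _ _).1 h).1
    have hm0 : (m : ℂ) ≠ 0 := by exact_mod_cast hm
    have hms : (m : ℂ) ^ s ≠ 0 := fun h => hm0 ((Complex.cpow_eq_zero_iff _ _).1 h).1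
    rw [LSeries.term_of_ne_zero (mul_ne_zero hq hm), LSeries.term_of_ne_zero hm,
      shiftSeq_apply_mul hq, Nat.cast_mul, Complex.natCast_mul_natCast_cpow, Complex.cpow_neg]
    field_simp

/-- The terms of the Dirichlet series of `shiftSeq q f` vanish off the multiples of `q`. [folklore] -/
theorem term_shiftSeq_eq_zero_of_not_dvd {q n : ℕ} (h : ¬ q ∣ n) (f : ℕ → ℂ) (s : ℂ) :
    LSeries.term (shiftSeq q f) s n = 0 := by
  rcases eq_or_ne n 0 with rfl | hn
  · exact LSeries.term_zero _ _
  · rw [LSeries.term_of_ne_zero hn, shiftSeq_apply_of_not_dvd h, zero_div]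

/-- The support of the terms of `shiftSeq q f` is contained in the multiples of `q`. [folklore] -/
theorem support_term_shiftSeq_subset (q : ℕ) (f : ℕ → ℂ) (s : ℂ) :
    Function.support (LSeries.term (shiftSeq q f) s) ⊆ Set.range (fun m : ℕ => q * m) := by
  intro n hn
  rw [Function.mem_support] at hn
  by_cases h : q ∣ n
  · obtain ⟨m, rfl⟩ := h
    exact ⟨m, rfl⟩
  · exact absurd (term_shiftSeq_eq_zero_of_not_dvd h f s) hn

/-- **`∑ₙ [shiftSeq q f](n) n^{-s} = q^{-s} ∑ₙ f(n) n^{-s}`** for `q ≥ 1` and every `s` (Mathlib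
`LSeries`; no convergence hypothesis: reindex `n = qm`, `Function.Injective.tsum_eq`). [folklore] -/
theorem LSeries_shiftSeq {q : ℕ} (hq : q ≠ 0) (f : ℕ → ℂ) (s : ℂ) :
    LSeries (shiftSeq q f) s = (q : ℂ) ^ (-s) * LSeries f s := by
  have hinj : Function.Injective (fun m : ℕ => q * m) := mul_right_injective₀ hq
  rw [LSeries, LSeries, ← hinj.tsum_eq (support_term_shiftSeq_subset q f s)]
  simp only [term_shiftSeq_mul hq]
  rw [tsum_mul_left]

/-- Absolute convergence passes to shifts: `LSeriesSummable f s → LSeriesSummable (shiftSeq q f) s`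
(`q ≥ 1`). [folklore] -/
theorem lseriesSummable_shiftSeq {f : ℕ → ℂ} {s : ℂ} (h : LSeriesSummable f s) {q : ℕ}
    (hq : q ≠ 0) : LSeriesSummable (shiftSeq q f) s := by
  have hinj : Function.Injective (fun m : ℕ => q * m) := mul_right_injective₀ hq
  have hzero : ∀ n ∉ Set.range (fun m : ℕ => q * m), LSeries.term (shiftSeq q f) s n = 0 := by
    intro n hn
    by_contra h'
    exact hn (support_term_shiftSeq_subset q f s (Function.mem_support.2 h'))
  rw [LSeriesSummable, ← hinj.summable_iff hzero]
  have : (LSeries.term (shiftSeq q f) s ∘ fun m : ℕ => q * m) =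
      fun m => (q : ℂ) ^ (-s) * LSeries.term f s m := by
    funext m
    exact term_shiftSeq_mul hq f s m
  rw [this]
  exact h.mul_left _

/-- Absolute convergence passes to character twists (`|χ(n)| ≤ 1`,
Mathlib `DirichletCharacter.norm_le_one`). [folklore] -/
theorem lseriesSummable_mul_dirichlet {a : ℕ → ℂ} {s : ℂ} (h : LSeriesSummable a s) {M : ℕ}
    (χ : DirichletCharacter ℂ M) : LSeriesSummable (a * fun n : ℕ => χ (n : ZMod M)) s := by
  refine Summable.of_norm_bounded (g := fun n => ‖LSeries.term a s n‖) h.norm (fun n => ?_)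
  rcases eq_or_ne n 0 with rfl | hn
  · simp [LSeries.term_zero]
  · rw [LSeries.term_of_ne_zero hn, LSeries.term_of_ne_zero hn, Pi.mul_apply, norm_div, norm_div,
      norm_mul]
    have h1 := DirichletCharacter.norm_le_one χ (n : ZMod M)
    have h2 : 0 ≤ ‖a n‖ := norm_nonneg _
    calc ‖a n‖ * ‖χ (n : ZMod M)‖ / ‖(n : ℂ) ^ s‖ ≤ ‖a n‖ * 1 / ‖(n : ℂ) ^ s‖ := by gcongr
      _ = ‖a n‖ / ‖(n : ℂ) ^ s‖ := by rw [mul_one]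

/-- Dirichlet-series form for `a` with `a 0 = 0`:
`D_a(s; x) = ∑ᵢ cᵢ qᵢ^{-s} ∑ₙ a(n) χᵢ(n) n^{-s}` wherever `∑ |a(n)| n^{-Re s} < ∞`.
[cite: Booker2003, proof of Lemma 1 pp. 1092–1093] -/
theorem exists_addTwist_eq_sum_charTwist₀ (ha0 : a 0 = 0)
    (hmul : ∀ m n, Nat.Coprime m n → a (m * n) = a m * a n) (x : ℚ) :
    ∃ (ι : Type) (_ : Fintype ι) (c : ι → ℂ) (q : ι → ℕ) (M : ι → ℕ)
      (χ : (i : ι) → DirichletCharacter ℂ (M i)),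
      (∀ i, q i ≠ 0) ∧ (∀ i, M i ≠ 0) ∧ ∀ s : ℂ, LSeriesSummable a s →
        addTwist a x s =
          ∑ i, c i * (q i : ℂ) ^ (-s) * LSeries (a * fun n : ℕ => χ i (n : ZMod (M i))) s := by
  obtain ⟨ι, hι, c, q, M, χ, hq, hM, h⟩ := exists_addTwistCoeff_eq_sum a ha0 hmul x
  refine ⟨ι, hι, c, q, M, χ, hq, hM, fun s hs => ?_⟩
  rw [addTwist_eq, h, LSeries_sum (fun i _ =>
    (lseriesSummable_shiftSeq (lseriesSummable_mul_dirichlet hs (χ i)) (hq i)).smul (c i))]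
  refine Finset.sum_congr rfl fun i _ => ?_
  rw [LSeries_smul, LSeries_shiftSeq (hq i), mul_assoc]

/-- **Booker 2003, proof of Lemma 1 (Dirichlet-series form): additive twists are finite
combinations of `q^{-s}` times character twists.**  For every sequence `a : ℕ → ℂ` multiplicative
on coprime non-zero arguments (`a(mn) = a(m) a(n)` for `m, n ≥ 1` coprime — the Dirichlet
coefficients of any Euler product; the value `a 0` is irrelevant) and every rational `x` there are
finitely many `cᵢ ∈ ℂ`, `qᵢ ≥ 1` and Dirichlet characters `χᵢ` mod `Mᵢ ≥ 1` such that
`D_a(s; x) = ∑ₙ a(n) e(nx) n^{-s} = ∑ᵢ cᵢ qᵢ^{-s} ∑ₙ a(n) χᵢ(n) n^{-s}` (`LSeries.addTwist`,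
Mathlib `LSeries`) for every `s` with `∑ |a(n)| n^{-Re s} < ∞` (`LSeriesSummable a s`).  This is
the statement "`L(s, ρ, α) ∈ V`" of the printed proof; the meromorphic continuation of the
right-hand side (each `∑ a(n)χ(n)n^{-s}` being `L(s, ρ ⊗ χ_prim)` up to finitely many Euler
factors) is the remaining, analytic, half of Lemma 1.
[cite: Booker2003, proof of Lemma 1 pp. 1092–1093] -/
theorem exists_addTwist_eq_sum_charTwist
    (hmul : ∀ m n, m ≠ 0 → n ≠ 0 → Nat.Coprime m n → a (m * n) = a m * a n) (x : ℚ) :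
    ∃ (ι : Type) (_ : Fintype ι) (c : ι → ℂ) (q : ι → ℕ) (M : ι → ℕ)
      (χ : (i : ι) → DirichletCharacter ℂ (M i)),
      (∀ i, q i ≠ 0) ∧ (∀ i, M i ≠ 0) ∧ ∀ s : ℂ, LSeriesSummable a s →
        addTwist a x s =
          ∑ i, c i * (q i : ℂ) ^ (-s) * LSeries (a * fun n : ℕ => χ i (n : ZMod (M i))) s := by
  -- replace `a` by `a'` vanishing at `0`
  set a' : ℕ → ℂ := fun n => if n = 0 then 0 else a n with ha'
  have ha'0 : a' 0 = 0 := by simp [ha']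
  have ha'eq : ∀ {n : ℕ}, n ≠ 0 → a' n = a n := fun hn => by simp [ha', hn]
  have hmul' : ∀ m n, Nat.Coprime m n → a' (m * n) = a' m * a' n := by
    intro m n hmn
    rcases eq_or_ne m 0 with rfl | hm
    · simp [ha']
    rcases eq_or_ne n 0 with rfl | hn
    · simp [ha']
    rw [ha'eq (mul_ne_zero hm hn), ha'eq hm, ha'eq hn, hmul m n hm hn hmn]
  obtain ⟨ι, hι, c, q, M, χ, hq, hM, h⟩ := exists_addTwist_eq_sum_charTwist₀ a' ha'0 hmul' x
  refine ⟨ι, hι, c, q, M, χ, hq, hM, fun s hs => ?_⟩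
  have hs' : LSeriesSummable a' s := (LSeriesSummable_congr s fun hn => ha'eq hn).2 hs
  have h1 : addTwist a x s = addTwist a' x s :=
    LSeries_congr (fun hn => by simp only [addTwistCoeff_apply, ha'eq hn]) s
  have h2 : ∀ i, LSeries (a * fun n : ℕ => χ i (n : ZMod (M i))) s =
      LSeries (a' * fun n : ℕ => χ i (n : ZMod (M i))) s :=
    fun i => LSeries_congr (fun hn => by simp only [Pi.mul_apply, ha'eq hn]) s
  rw [h1, h s hs']
  exact Finset.sum_congr rfl fun i _ => by rw [h2 i]

end LSeries

end Literature.NumberTheory.LFunctions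

end
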